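import Literature.NumberTheory.LFunctions.BurnolCoPoissonSubspace
import Literature.NumberTheory.LFunctions.BurnolSonineHardyStrip
import Literature.NumberTheory.LFunctions.BurnolSonineEvaluators
import Literature.NumberTheory.LFunctions.ZetaZerosProofs
import Mathlib.NumberTheory.Harmonic.ZetaAsymp
import HarnessLib

/-!
# The co-Poisson sums correspond to `ζ(s)` under the right Mellin transform: `F̂(s) = ζ(s)ĝ(s)` for
# every `F ∈ P_a` (datum `g ∈ L¹(a, 1/a)`), and `P_a ⊆ L_a ∩ Y_a^⊥` (Thm. 3.1, clause 3, inclusion)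

LINE 1 — LABEL: RH-FREE (a Müntz-type Mellin identity for the `L²` co-Poisson sums of Burnol's
co-Poisson subspace `P_a ⊂ L_a`, and its vanishing, with the right multiplicity, at the non-trivial
zeros of `ζ` WHEREVER they are). FRAMING (cell rh-crit, D-0074): corpus theorems are RH-FREE
literature; nothing here is worded as progress toward RH. bears_on: B-C/B-P (LADDER-RH COLUMN 6, de
Branges framework) as infrastructure for the §3/§6 records of [Burnol2004b] (Thm. 3.1 clause 3
"the perpendicular complement to `Y_a` is `P_a`": the inclusion `P_a ⊆ Y_a^⊥`). WHAT THIS IS NOT: not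
a criterion, not a route, no positivity — "the co-Poisson subspace is orthogonal to the
zero-evaluators" holds whatever the zeros are; nothing here bears on the truth of RH.

Sources. J.-F. Burnol, *On Fourier and Zeta(s)*, Forum Math. 16 (2004) 789–840 = arXiv:math/0112254
[Burnol2004], Note 2.5 (TeX of record `dbl/src/Burnol2004ForumMath_arXivmath0112254.tex` l.737–758:
"it is in truth not the original Poisson summation but the Müntz-modified Poisson … which corresponds
to `ζ(s)` as multiplier", after [Titchmarsh1986, §2.11]), §4 (TeX l.1384–1400: "If, rather, we use
the *right* convention we are bound to associate to `ζ(s)` the *co-Poisson sums*") and §6 (TeX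
l.2180–2187); J.-F. Burnol, *Two complete and minimal systems associated with the zeros of the
Riemann zeta function*, JTNB 16 (2004) 65–94 = arXiv:math/0203120v7 [Burnol2004b], §2 (TeX of record
`dbl/src/Burnol2004JTNB_arXivmath0203120v7.tex` l.393–404: the co-Poisson formula "using the right
Mellin transform `ĝ(s) = ∫₀^∞ g(t)t^{−s}dt`" for `g` integrable supported in `[a, A]`, `A = 1/a`;
Definition of `P_a`, l.493–498: "the subspace of square-integrable functions `F(t)` which are
co-Poisson sums of a function `g ∈ L¹(a, A; dt)`"), Thm. 3.1 (TeX l.516–525: "For `a < 1` the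
perpendicular complement to `Y_a` is the co-Poisson subspace `P_a`") and the proof of Prop. 6.4 (TeX
l.1287–1292: the `Y^a_{ρ,k}`, `a < 1`, "are not complete from the existence of the co-Poisson
subspace `P_a`").

RELATION TO THE TREE (cited, not restated). `BurnolCoPoissonEvaluatorOrthogonality.lean` proves the
same Mellin identity `P'(α)^ = ζ·α̂` and the orthogonality `⟪P'(α), Y⟫ = 0` for SMOOTH test data
`α` (even, compact support away from `0`, `IsTestAway`, with BOTH moments `∫α = ∫α(u)du/u = 0`, i.e.
for the subspace `W'_a = P_a ∩ K_a` of TeX l.500–512), which suffices for the NON-COMPLETENESS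
clauses (`not_isCompleteSystemIn_sonineL_burnolYSystem`, `Burnol2004b_prop6_4_holds`); those are not
repeated here. The present module treats the GENERAL datum `g ∈ L¹(a, 1/a)` of the tree's definition
`coPoissonP` (`BurnolZetaSystems.lean`), i.e. EVERY element of `P_a` — no smoothness, no vanishing
moment —, which is what the set identity of Thm. 3.1 clause 3 (the hypothesis `hperp` of
`Burnol2004b_thm3_1_of`, `BurnolZetaSystemsProofs.lean`) quantifies over; the `L²` input replacing
the Schwartz decay of `P'(α)` is the tree's co-Poisson intertwining `coPoissonP_subset_sonineL` /
`coPoissonSum_ae_eq_const` (`BurnolCoPoissonSubspace.lean`) and the strip theory of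
`BurnolSonineHardyStrip.lean` (`rightMellin_eq_of_ae_eq_const`, `HasRightMellinContinuation.eqOn`).

## What is PROVED (theorem-only module: no definition, no named fact)

For `0 < a`, a datum `g ∈ L¹(a, 1/a)` (zero off `(a, 1/a)`) and `F ∈ L²(ℝ)` with
`F = Σ_{n≥1} g(|t|/n)/n − ∫₀^∞ g(u)du/u` a.e. (i.e. `F ∈ coPoissonP a` with datum `g`), all names in
the namespace `Literature.NumberTheory.LFunctions.CoPoissonMellin`:

* `mellinConvergent_datum`, `differentiable_rightMellin_datum` — `ĝ(s) = ∫₀^∞ g t^{−s}` converges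
  absolutely for every `s` and is entire;
* `integral_cpow_mul_tsum_eq` — for `Re s > 1`, `∫₀^∞ t^{−s} Σ_{n≥1} g(t/n)/n dt = ζ(s) ĝ(s)`
  (termwise, `∫₀^∞ t^{−s}g(t/n)/n dt = n^{−s}ĝ(s)`: Müntz / [Titchmarsh1986, §2.11]);
* `mellin_indicator_eq_of_one_lt_re`, `mellin_indicator_eq` — the tail transform
  `∫_a^∞ F(t)t^{−s}dt = ζ(s)ĝ(s) + c·a^{1−s}/(1−s)` (`c = ∫₀^∞ g(u)du/u`) first on `Re s > 1`, then on
  `Re s > 1/2`, `s ≠ 1` by analytic continuation (`(s−1)·` both sides; Mathlib's entire `riemannZeta₁`);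
* **`rightMellin_eq_zeta_mul`**, **`rightMellin_eq_zeta_mul_of_mem_coPoissonP`** — `F̂(s) = ζ(s)·ĝ(s)`
  on the strip `1/2 < Re s < 1` (Burnol: "we are bound to associate to `ζ(s)` the co-Poisson sums");
* `hasRightMellinContinuation`, `rightMellinExt_eq` — the continuation `G_F = ζ·ĝ` off `s = 1`;
  `completedMellin_eq` — `M(F)(s) = Λ(s)·ĝ(s)` (`Λ = completedRiemannZeta`) for `0 < Re s`, `s ≠ 1`;
* **`burnolEval_eq_zero`**, **`burnolEval_eq_zero_of_mem_coPoissonP`** — `M(F)^{(k)}(ρ) = 0` for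
  every non-trivial zero `ρ` and every `k < m_ρ`; hence `setIntegral_mul_burnolY_eq_zero`
  (`[F, Y^a_{ρ,k}] = 0` for Burnol's bilinear form `[f,g] = ∫₀^∞ fg`);
* `coPoissonSum_conj`, `star_mem_coPoissonP` — `P_a` is stable under complex conjugation (datum `ḡ`);
  hence **`inner_burnolYSystem_eq_zero`** (`⟪Y^a_{ρ,k}, F⟫ = 0` for every `F ∈ P_a`),
  `mem_orthogonal_span_burnolYSystem`, `inner_eq_zero_of_mem_burnolYa` (`P_a ⊥ Y_a`) and
  **`coPoissonP_subset_sonineL_inter_orthogonal`**: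
  `coPoissonP a ⊆ {f ∈ sonineL a | ∀ p, ⟪burnolYSystem a p, f⟫ = 0}` — the inclusion `⊇` of the set
  identity of [Burnol2004b, Thm. 3.1 clause 3] in the exact shape of the hypothesis `hperp` of
  `Burnol2004b_thm3_1_of`. The reverse inclusion `Y_a^⊥ ∩ L_a ⊆ P_a` is [Burnol2004, Thms. 6.24,
  6.25] (TeX l.1294–1300 of [Burnol2004b]) and is NOT proved here; and
  `not_isCompleteSystemIn_of_mem_coPoissonP` — a non-zero element of `P_a` witnesses the
  non-completeness of the `Y^a_{ρ,k}` in `L_a` (the mechanism of the proof of Prop. 6.4).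

## References

* [Burnol2004] J.-F. Burnol, *On Fourier and Zeta(s)*, Forum Math. 16 (2004) 789–840, Note 2.5,
  §4, §6. [cite: Burnol2004, Note 2.5 (TeX l.737–758), §4 (TeX l.1384–1400), §6 (TeX l.2180–2187)]
* [Burnol2004b] J.-F. Burnol, JTNB 16 (2004) 65–94, §2, Thm. 3.1 and Prop. 6.4.
  [cite: Burnol2004b, §2 (arXiv:math/0203120v7 p. 5, TeX l.393–404, 493–498), Thm. 3.1 (p. 6, TeX l.516–525), Prop. 6.4 (p. 16, TeX l.1282–1292), §6 (p. 16, TeX l.1294–1300)]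
* [Titchmarsh1986] E. C. Titchmarsh, *The Theory of the Riemann Zeta-Function*, 2nd ed., §2.11
  (Müntz's formula).
-/

noncomputable section

open MeasureTheory Complex Filter Set Asymptotics
open scoped Topology FourierTransform ENNReal ComplexConjugate InnerProductSpace

namespace Literature.NumberTheory.LFunctions

namespace CoPoissonMellin

variable {a : ℝ} {g : ℝ → ℂ}

/-! ## §1 The datum `g ∈ L¹(a, 1/a)` and its entire right Mellin transform `ĝ` -/

/-- A datum vanishing off `(a, 1/a)` is its own indicator. [folklore] -/
private theorem datum_eq_indicator (hgz : ∀ t, t ∉ Ioo a a⁻¹ → g t = 0) :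
    g = (Ioo a a⁻¹).indicator g := by
  funext t
  by_cases ht : t ∈ Ioo a a⁻¹
  · rw [indicator_of_mem ht]
  · rw [indicator_of_notMem ht, hgz t ht]

/-- The datum is integrable on `ℝ`. [folklore] -/
private theorem integrable_datum (hgi : IntegrableOn g (Ioo a a⁻¹)) (hgz : ∀ t, t ∉ Ioo a a⁻¹ → g t = 0) :
    Integrable g := by
  rw [datum_eq_indicator hgz]
  exact hgi.integrable_indicator measurableSet_Ioo

/-- The datum vanishes near `+∞`. [folklore] -/
private theorem datum_eventuallyEq_zero_atTop
    (hgz : ∀ t, t ∉ Ioo a a⁻¹ → g t = 0) : g =ᶠ[atTop] (0 : ℝ → ℂ) := by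
  filter_upwards [eventually_gt_atTop a⁻¹] with t ht
  exact hgz t (fun h ↦ (lt_irrefl _ (h.2.trans ht)).elim)

/-- The datum vanishes near `0⁺`. [folklore] -/
private theorem datum_eventuallyEq_zero_nhdsGT (ha : 0 < a)
    (hgz : ∀ t, t ∉ Ioo a a⁻¹ → g t = 0) : g =ᶠ[𝓝[>] 0] (0 : ℝ → ℂ) := by
  filter_upwards [Ioo_mem_nhdsGT ha] with t ht
  exact hgz t (fun h ↦ (lt_irrefl _ (ht.2.trans h.1)).elim)

/-- **`ĝ(s) = ∫₀^∞ g(t)t^{−s}dt` converges absolutely for every `s`** (`g ∈ L¹` supported in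
`[a, 1/a] ⊂ (0,∞)`). [cite: Burnol2004b, §2 (arXiv:math/0203120v7 p. 5, TeX l.393–397)] -/
theorem mellinConvergent_datum (ha : 0 < a) (hgi : IntegrableOn g (Ioo a a⁻¹))
    (hgz : ∀ t, t ∉ Ioo a a⁻¹ → g t = 0) (s : ℂ) : MellinConvergent g s := by
  refine mellinConvergent_of_isBigO_rpow (a := s.re + 1) (b := s.re - 1)
    ((integrable_datum hgi hgz).locallyIntegrable.locallyIntegrableOn _) ?_ (by linarith) ?_
    (by linarith)
  · exact (isBigO_zero _ _).congr' (datum_eventuallyEq_zero_atTop hgz).symm EventuallyEq.rfl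
  · exact (isBigO_zero _ _).congr' (datum_eventuallyEq_zero_nhdsGT ha hgz).symm EventuallyEq.rfl

/-- `mellin g` is entire. [cite: Burnol2004b, §2 (arXiv:math/0203120v7 p. 5, TeX l.393–397)] -/
theorem differentiableAt_mellin_datum (ha : 0 < a) (hgi : IntegrableOn g (Ioo a a⁻¹))
    (hgz : ∀ t, t ∉ Ioo a a⁻¹ → g t = 0) (s : ℂ) : DifferentiableAt ℂ (mellin g) s := by
  refine mellin_differentiableAt_of_isBigO_rpow (a := s.re + 1) (b := s.re - 1)
    ((integrable_datum hgi hgz).locallyIntegrable.locallyIntegrableOn _) ?_ (by linarith) ?_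
    (by linarith)
  · exact (isBigO_zero _ _).congr' (datum_eventuallyEq_zero_atTop hgz).symm EventuallyEq.rfl
  · exact (isBigO_zero _ _).congr' (datum_eventuallyEq_zero_nhdsGT ha hgz).symm EventuallyEq.rfl

/-- **`ĝ` is an entire function of `s`.** [cite: Burnol2004b, §2 (arXiv:math/0203120v7 p. 5, TeX l.393–397)] -/
theorem differentiable_rightMellin_datum (ha : 0 < a) (hgi : IntegrableOn g (Ioo a a⁻¹))
    (hgz : ∀ t, t ∉ Ioo a a⁻¹ → g t = 0) : Differentiable ℂ (rightMellin g) := by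
  intro s
  have h : rightMellin g = fun s ↦ mellin g (1 - s) := rfl
  rw [h]
  exact (differentiableAt_mellin_datum ha hgi hgz (1 - s)).comp s
    ((differentiableAt_const _).sub differentiableAt_id)

/-! ## §2 `∫₀^∞ t^{−s} Σ_{n≥1} g(t/n)/n dt = ζ(s)ĝ(s)` for `Re s > 1` -/

/-- The dilated terms vanish on `(0, a]`: for `0 < t ≤ a`, `g(|t|/(n+1)) = 0`. [folklore] -/
private theorem term_eq_zero_of_le (hgz : ∀ t, t ∉ Ioo a a⁻¹ → g t = 0) {t : ℝ} (ht0 : 0 < t)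
    (hta : t ≤ a) (n : ℕ) : g (|t| / ((n : ℝ) + 1)) = 0 := by
  apply hgz
  intro h
  have hn1 : (1 : ℝ) ≤ (n : ℝ) + 1 := by linarith [n.cast_nonneg (α := ℝ)]
  have hle : |t| / ((n : ℝ) + 1) ≤ a := by
    rw [abs_of_pos ht0]
    exact (div_le_self ht0.le hn1).trans hta
  exact not_lt.2 hle h.1

/-- The series part of a co-Poisson sum vanishes on `(0, a]`. [cite: Burnol2004b, §2 (arXiv:math/0203120v7 p. 5, TeX l.397–401)] -/
theorem tsum_eq_zero_of_le (hgz : ∀ t, t ∉ Ioo a a⁻¹ → g t = 0) {t : ℝ} (ht0 : 0 < t)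
    (hta : t ≤ a) : ∑' n : ℕ, g (|t| / ((n : ℝ) + 1)) / ((n : ℂ) + 1) = 0 := by
  have h : ∀ n : ℕ, g (|t| / ((n : ℝ) + 1)) / ((n : ℂ) + 1) = 0 := fun n ↦ by
    rw [term_eq_zero_of_le hgz ht0 hta n, zero_div]
  rw [tsum_congr h, tsum_zero]

/-- **Termwise integration for `Re s > 1`**: `∫₀^∞ t^{−s} Σ_{n≥1} g(t/n)/n dt = ζ(s)ĝ(s)`
(`∫₀^∞ t^{−s}g(t/n)/n dt = n^{−s}ĝ(s)`, `Σ n^{−s} = ζ(s)`; Burnol: "For `Re(s) > 1` we may intervert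
the integral with the summation"). [cite: Burnol2004, Note 2.5 (TeX l.737–743)] -/
theorem integral_cpow_mul_tsum_eq (ha : 0 < a) (hgi : IntegrableOn g (Ioo a a⁻¹))
    (hgz : ∀ t, t ∉ Ioo a a⁻¹ → g t = 0) {s : ℂ} (hs : 1 < s.re) :
    ∫ t in Ioi (0 : ℝ), (t : ℂ) ^ (-s) * ∑' n : ℕ, g (|t| / ((n : ℝ) + 1)) / ((n : ℂ) + 1) =
      riemannZeta s * rightMellin g s := by
  set σ : ℝ := s.re with hσ
  -- the pieces
  set F : ℕ → ℝ → ℂ := fun n t ↦ (t : ℂ) ^ (-s) * (g (|t| / ((n : ℝ) + 1)) / ((n : ℂ) + 1)) with hF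
  have hconv : MellinConvergent g (1 - s) := mellinConvergent_datum ha hgi hgz (1 - s)
  have hm : ∀ n : ℕ, (0 : ℝ) < (n : ℝ) + 1 := fun n ↦ by positivity
  have hmc : ∀ n : ℕ, ((n : ℂ) + 1) ≠ 0 := fun n ↦ by
    have : ((((n : ℝ) + 1 : ℝ)) : ℂ) ≠ 0 := ofReal_ne_zero.2 (hm n).ne'
    push_cast at this; exact this
  -- integrability of each piece on `(0, ∞)`
  have hFint : ∀ n, Integrable (F n) (volume.restrict (Ioi 0)) := by
    intro n
    have h1 : MellinConvergent (fun t ↦ g (((n : ℝ) + 1)⁻¹ * t)) (1 - s) :=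
      (MellinConvergent.comp_mul_left (inv_pos.2 (hm n))).2 hconv
    have h2 : Integrable (fun t : ℝ ↦ ((n : ℂ) + 1)⁻¹ *
        ((t : ℂ) ^ (1 - s - 1) • g (((n : ℝ) + 1)⁻¹ * t))) (volume.restrict (Ioi 0)) :=
      h1.const_mul _
    refine h2.congr ?_
    filter_upwards [ae_restrict_mem measurableSet_Ioi] with t ht
    have ht0 : (0 : ℝ) < t := ht
    simp only [hF, smul_eq_mul, sub_sub_cancel_left, abs_of_pos ht0, div_eq_mul_inv,
      mul_comm t]
    ring
  -- the norms: `∫‖F n‖ = (n+1)^{-σ} ∫₀^∞ u^{-σ}‖g u‖du`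
  set G : ℝ := ∫ u in Ioi (0 : ℝ), u ^ (-σ) * ‖g u‖ with hG
  have hnormF : ∀ (n : ℕ) (t : ℝ), 0 < t →
      ‖F n t‖ = ((n : ℝ) + 1)⁻¹ * (t ^ (-σ) * ‖g (t / ((n : ℝ) + 1))‖) := by
    intro n t ht
    simp only [hF, norm_mul, norm_div, norm_cpow_eq_rpow_re_of_pos ht, neg_re, abs_of_pos ht]
    have : ‖(n : ℂ) + 1‖ = (n : ℝ) + 1 := by
      rw [show (n : ℂ) + 1 = (((n : ℝ) + 1 : ℝ) : ℂ) by push_cast; rfl, Complex.norm_real,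
        Real.norm_of_nonneg (hm n).le]
    rw [this]
    ring
  have hFnorm : ∀ n : ℕ, ∫ t in Ioi (0 : ℝ), ‖F n t‖ = ((n : ℝ) + 1) ^ (-σ) * G := by
    intro n
    have hmn := hm n
    have h1 : ∫ t in Ioi (0 : ℝ), ‖F n t‖ =
        ∫ t in Ioi (0 : ℝ), ((n : ℝ) + 1)⁻¹ * (t ^ (-σ) * ‖g (t / ((n : ℝ) + 1))‖) :=
      setIntegral_congr_fun measurableSet_Ioi fun t ht ↦ hnormF n t ht
    -- substitution `t = (n+1) u`
    have h2 : ∫ t in Ioi (0 : ℝ), t ^ (-σ) * ‖g (t / ((n : ℝ) + 1))‖ =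
        ((n : ℝ) + 1) ^ (1 - σ) * G := by
      have hsub := integral_comp_mul_left_Ioi
        (fun t : ℝ ↦ t ^ (-σ) * ‖g (t / ((n : ℝ) + 1))‖) 0 hmn
      rw [mul_zero] at hsub
      have hfun : (fun u : ℝ ↦ (fun t : ℝ ↦ t ^ (-σ) * ‖g (t / ((n : ℝ) + 1))‖)
          (((n : ℝ) + 1) * u)) = fun u ↦ ((n : ℝ) + 1) ^ (-σ) * (u ^ (-σ) * ‖g u‖) := by
        funext u
        simp only
        rw [mul_div_cancel_left₀ u hmn.ne']
        by_cases hu : 0 ≤ u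
        · rw [Real.mul_rpow hmn.le hu]; ring
        · have hu' : u ∉ Ioo a a⁻¹ := fun h ↦ hu (ha.le.trans h.1.le)
          rw [hgz u hu', norm_zero, mul_zero, mul_zero, mul_zero]
      rw [hfun, integral_const_mul] at hsub
      -- `hsub : (n+1)^{-σ} * G = (n+1)⁻¹ • ∫ …`
      rw [smul_eq_mul] at hsub
      have : ∫ t in Ioi (0 : ℝ), t ^ (-σ) * ‖g (t / ((n : ℝ) + 1))‖ =
          ((n : ℝ) + 1) * (((n : ℝ) + 1) ^ (-σ) * G) := by
        rw [hsub]; field_simp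
      rw [this, ← mul_assoc, Real.rpow_sub hmn, Real.rpow_one, Real.rpow_neg hmn.le]
      field_simp
    rw [h1, integral_const_mul, h2, ← mul_assoc, Real.rpow_sub hmn, Real.rpow_one,
      Real.rpow_neg hmn.le]
    field_simp
  have hsum : Summable fun n ↦ ∫ t in Ioi (0 : ℝ), ‖F n t‖ := by
    simp_rw [hFnorm]
    refine Summable.mul_right _ ?_
    have h := (summable_nat_add_iff 1).2 (Real.summable_nat_rpow.2 (by linarith : -σ < -1))
    exact_mod_cast h
  -- `ĝ(s)` as an integral of `u^{-s} g(u)`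
  have hright : rightMellin g s = ∫ u in Ioi (0 : ℝ), (u : ℂ) ^ (-s) * g u := by
    simp only [rightMellin, mellin, smul_eq_mul, sub_sub_cancel_left]
  -- termwise values: `∫₀^∞ t^{-s} g(t/(n+1))/(n+1) dt = (n+1)^{-s} ĝ(s)`
  have hterm : ∀ n : ℕ, ∫ t in Ioi (0 : ℝ), F n t = 1 / ((n : ℂ) + 1) ^ s * rightMellin g s := by
    intro n
    have hmn := hm n
    have hsub := integral_comp_mul_left_Ioi (fun t : ℝ ↦ F n t) 0 hmn
    rw [mul_zero] at hsub
    -- on `(0, ∞)` the substituted integrand is `C · u^{-s} g(u)`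
    set C : ℂ := ((((n : ℝ) + 1 : ℝ)) : ℂ) ^ (-s) / ((n : ℂ) + 1) with hC
    have hcongr : ∫ u in Ioi (0 : ℝ), (fun t : ℝ ↦ F n t) (((n : ℝ) + 1) * u) =
        ∫ u in Ioi (0 : ℝ), C * ((u : ℂ) ^ (-s) * g u) := by
      refine setIntegral_congr_fun measurableSet_Ioi fun u hu ↦ ?_
      have hu0 : (0 : ℝ) < u := hu
      simp only [hF, hC]
      rw [abs_of_pos (mul_pos hmn hu0), mul_div_cancel_left₀ u hmn.ne', ofReal_mul,
        mul_cpow_ofReal_nonneg hmn.le hu0.le]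
      ring
    rw [hcongr, integral_const_mul, ← hright] at hsub
    -- solve for `∫ F n`
    have hmc' : ((((n : ℝ) + 1 : ℝ)) : ℂ) = (n : ℂ) + 1 := by push_cast; rfl
    have hinv : (((n : ℝ) + 1)⁻¹ : ℝ) ≠ 0 := inv_ne_zero hmn.ne'
    have key : ∫ t in Ioi (0 : ℝ), F n t = (((n : ℝ) + 1 : ℝ) : ℂ) * (C * rightMellin g s) := by
      rw [hsub, Complex.real_smul, ← mul_assoc, ofReal_inv,
        mul_inv_cancel₀ (by rw [hmc']; exact hmc n), one_mul]
    have hne : (n : ℂ) + 1 ≠ 0 := hmc n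
    have hpow : ((n : ℂ) + 1) ^ s ≠ 0 := by
      rw [Ne, cpow_eq_zero_iff, not_and_or]
      exact Or.inl hne
    rw [key, hC, hmc', cpow_neg, one_div]
    field_simp
  calc ∫ t in Ioi (0 : ℝ), (t : ℂ) ^ (-s) * ∑' n : ℕ, g (|t| / ((n : ℝ) + 1)) / ((n : ℂ) + 1)
      = ∫ t in Ioi (0 : ℝ), ∑' n, F n t := by
        refine setIntegral_congr_fun measurableSet_Ioi fun t _ ↦ ?_
        simp only [hF]
        rw [tsum_mul_left]
    _ = ∑' n, ∫ t in Ioi (0 : ℝ), F n t := (integral_tsum_of_summable_integral_norm hFint hsum).symm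
    _ = ∑' n : ℕ, 1 / ((n : ℂ) + 1) ^ s * rightMellin g s := tsum_congr hterm
    _ = riemannZeta s * rightMellin g s := by
        rw [tsum_mul_right, zeta_eq_tsum_one_div_nat_add_one_cpow hs]

/-! ## §3 The tail transform `∫_a^∞ F(t)t^{−s}dt` of an `L²` co-Poisson sum -/

section Tail

variable {F : Lp ℂ 2 (volume : Measure ℝ)}

/-- The constant `c = ∫₀^∞ g(u)du/u = ĝ(1)` of the co-Poisson sum. [cite: Burnol2004b, §2 (arXiv:math/0203120v7 p. 5, TeX l.397–401)] -/
theorem rightMellin_datum_one (g : ℝ → ℂ) :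
    rightMellin g 1 = ∫ u in Ioi (0 : ℝ), g u / (u : ℂ) := by
  simp only [rightMellin, mellin, sub_self, zero_sub, smul_eq_mul]
  refine setIntegral_congr_fun measurableSet_Ioi fun u hu ↦ ?_
  have hu0 : (0 : ℝ) < u := hu
  rw [cpow_neg_one, div_eq_inv_mul]

/-- `t ↦ t^{−s}` is square-integrable on `(a, ∞)` for `Re s > 1/2` (`a > 0`). [folklore] -/
private theorem memLp_cpow_neg_Ioi (ha : 0 < a) {s : ℂ} (hs : 1 / 2 < s.re) :
    MemLp (fun t : ℝ ↦ (t : ℂ) ^ (-s)) 2 (volume.restrict (Ioi a)) := by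
  have hmeas : AEStronglyMeasurable (fun t : ℝ ↦ (t : ℂ) ^ (-s)) (volume.restrict (Ioi a)) := by
    refine ContinuousOn.aestronglyMeasurable (fun t ht ↦ ?_) measurableSet_Ioi
    exact (Complex.continuousAt_ofReal_cpow_const _ _ (Or.inr (ha.trans ht).ne')).continuousWithinAt
  refine (memLp_two_iff_integrable_sq_norm hmeas).2 ?_
  have h : IntegrableOn (fun t : ℝ ↦ t ^ (-(2 * s.re))) (Ioi a) :=
    integrableOn_Ioi_rpow_of_lt (by linarith) ha
  refine h.congr_fun (fun t ht ↦ ?_) measurableSet_Ioi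
  have ht0 : (0 : ℝ) < t := ha.trans ht
  rw [norm_cpow_eq_rpow_re_of_pos ht0, neg_re, ← Real.rpow_natCast, ← Real.rpow_mul ht0.le]
  push_cast
  ring_nf

/-- `t^{−s} F(t)` is integrable on `(a, ∞)` for `F ∈ L²`, `Re s > 1/2`. [folklore] -/
private theorem integrableOn_cpow_mul (ha : 0 < a) (F : Lp ℂ 2 (volume : Measure ℝ)) {s : ℂ}
    (hs : 1 / 2 < s.re) :
    IntegrableOn (fun t : ℝ ↦ (t : ℂ) ^ (-s) * (F : ℝ → ℂ) t) (Ioi a) :=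
  (memLp_cpow_neg_Ioi ha hs).integrable_mul ((Lp.memLp F).restrict _)

/-- The tail transform is the Mellin transform of the truncation: for every `s`,
`mellin (𝟙_{(a,∞)}F) (1 − s) = ∫_a^∞ t^{−s} F(t) dt`. [folklore] -/
private theorem mellin_indicator_eq_setIntegral (ha : 0 < a) (F : ℝ → ℂ) (s : ℂ) :
    mellin ((Ioi a).indicator F) (1 - s) = ∫ t in Ioi a, (t : ℂ) ^ (-s) * F t := by
  simp only [mellin, smul_eq_mul, sub_sub_cancel_left]
  have hind : (fun t : ℝ ↦ (t : ℂ) ^ (-s) * (Ioi a).indicator F t) =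
      (Ioi a).indicator (fun t : ℝ ↦ (t : ℂ) ^ (-s) * F t) := by
    funext t
    by_cases ht : t ∈ Ioi a
    · rw [indicator_of_mem ht, indicator_of_mem ht]
    · rw [indicator_of_notMem ht, indicator_of_notMem ht, mul_zero]
  rw [hind, setIntegral_indicator measurableSet_Ioi,
    show Ioi (0 : ℝ) ∩ Ioi a = Ioi a from by rw [inter_eq_right]; exact Ioi_subset_Ioi ha.le]

/-- **The tail transform for `Re s > 1`**: if `F = Σ_{n≥1} g(|t|/n)/n − c` a.e.
(`c = ∫₀^∞ g(u)du/u`), then `∫_a^∞ t^{−s}F(t)dt = ζ(s)ĝ(s) + c·a^{1−s}/(1−s)`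
(`Σ`-part by §2 — it vanishes on `(0,a]` —, and `∫_a^∞ t^{−s}dt = a^{1−s}/(s−1)`).
[cite: Burnol2004, Note 2.5 (TeX l.737–750)] -/
theorem mellin_indicator_eq_of_one_lt_re (ha : 0 < a) (hgi : IntegrableOn g (Ioo a a⁻¹))
    (hgz : ∀ t, t ∉ Ioo a a⁻¹ → g t = 0) (hF : ∀ᵐ t : ℝ, F t = coPoissonSum g t) {s : ℂ}
    (hs : 1 < s.re) :
    mellin ((Ioi a).indicator (F : ℝ → ℂ)) (1 - s) =
      riemannZeta s * rightMellin g s +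
        (∫ u in Ioi (0 : ℝ), g u / (u : ℂ)) * (a : ℂ) ^ (1 - s) / (1 - s) := by
  set c : ℂ := ∫ u in Ioi (0 : ℝ), g u / (u : ℂ) with hc
  set S : ℝ → ℂ := fun t ↦ ∑' n : ℕ, g (|t| / ((n : ℝ) + 1)) / ((n : ℂ) + 1) with hS
  have hs1 : 1 - s ≠ 0 := by
    intro h
    have := congrArg Complex.re h
    simp only [sub_re, one_re, zero_re] at this
    linarith
  have hs2 : 1 / 2 < s.re := by linarith
  rw [mellin_indicator_eq_setIntegral ha]
  -- integrability on `(a, ∞)` of `t^{-s}F`, of `c t^{-s}`, hence of `t^{-s} S`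
  have hIF : IntegrableOn (fun t : ℝ ↦ (t : ℂ) ^ (-s) * (F : ℝ → ℂ) t) (Ioi a) :=
    integrableOn_cpow_mul ha F hs2
  have hIc : IntegrableOn (fun t : ℝ ↦ c * (t : ℂ) ^ (-s)) (Ioi a) :=
    (integrableOn_Ioi_cpow_of_lt (by simp only [neg_re]; linarith) ha).const_mul c
  have hae : ∀ᵐ t ∂(volume.restrict (Ioi a)),
      ((t : ℝ) : ℂ) ^ (-s) * (F : ℝ → ℂ) t = ((t : ℝ) : ℂ) ^ (-s) * S t - c * ((t : ℝ) : ℂ) ^ (-s) := by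
    filter_upwards [ae_restrict_of_ae (s := Ioi a) hF] with t ht
    rw [ht, coPoissonSum, hS, hc]
    ring
  have hIS : IntegrableOn (fun t : ℝ ↦ (t : ℂ) ^ (-s) * S t) (Ioi a) := by
    have h := hIF.add hIc
    refine h.congr ?_
    filter_upwards [hae] with t ht
    rw [Pi.add_apply, ht]
    ring
  -- the `Σ`-part: over `(a, ∞)` it is the full `(0, ∞)` integral
  have hS0 : ∫ t in Ioi a, (t : ℂ) ^ (-s) * S t = ∫ t in Ioi (0 : ℝ), (t : ℂ) ^ (-s) * S t := by
    symm
    refine setIntegral_eq_of_subset_of_forall_sdiff_eq_zero measurableSet_Ioi (Ioi_subset_Ioi ha.le)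
      fun t ht ↦ ?_
    have ht0 : (0 : ℝ) < t := ht.1
    have hta : t ≤ a := not_lt.1 ht.2
    rw [hS]
    simp only
    rw [tsum_eq_zero_of_le hgz ht0 hta, mul_zero]
  have hSval : ∫ t in Ioi (0 : ℝ), (t : ℂ) ^ (-s) * S t = riemannZeta s * rightMellin g s :=
    integral_cpow_mul_tsum_eq ha hgi hgz hs
  -- the constant part
  have hcval : ∫ t in Ioi a, c * (t : ℂ) ^ (-s) = -(c * (a : ℂ) ^ (1 - s) / (1 - s)) := by
    rw [integral_const_mul, integral_Ioi_cpow_of_lt (by simp only [neg_re]; linarith) ha,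
      show -s + 1 = 1 - s by ring]
    ring
  calc ∫ t in Ioi a, (t : ℂ) ^ (-s) * (F : ℝ → ℂ) t
      = ∫ t in Ioi a, ((t : ℂ) ^ (-s) * S t - c * (t : ℂ) ^ (-s)) := integral_congr_ae hae
    _ = (∫ t in Ioi a, (t : ℂ) ^ (-s) * S t) - ∫ t in Ioi a, c * (t : ℂ) ^ (-s) :=
        integral_sub hIS hIc
    _ = riemannZeta s * rightMellin g s + c * (a : ℂ) ^ (1 - s) / (1 - s) := by
        rw [hS0, hSval, hcval]; ring

/-- Holomorphy of the tail transform `z ↦ ∫_a^∞ t^{−z}F(t)dt` on `Re z > 1/2` (`F ∈ L²`; Burnol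
2001 CRAS §1, the tree's `SonineMellin.differentiableOn_mellin`). [cite: Burnol2004b, §4 (arXiv:math/0203120v7 p. 7, TeX l.632–638)] -/
theorem differentiableOn_mellin_indicator (ha : 0 < a) (F : Lp ℂ 2 (volume : Measure ℝ)) :
    DifferentiableOn ℂ (fun z ↦ mellin ((Ioi a).indicator (F : ℝ → ℂ)) (1 - z))
      {z | 1 / 2 < z.re} := by
  set T : ℝ → ℂ := (Ioi a).indicator (F : ℝ → ℂ) with hT
  have hTm : MemLp T 2 (volume : Measure ℝ) := (Lp.memLp F).indicator measurableSet_Ioi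
  set TL : Lp ℂ 2 (volume : Measure ℝ) := hTm.toLp T with hTL
  have hcoe : (TL : ℝ → ℂ) =ᵐ[volume] T := hTm.coeFn_toLp
  have hTa : ∀ᵐ x : ℝ, x ∈ Icc (-a) a → (TL : ℝ → ℂ) x = 0 := by
    filter_upwards [hcoe] with x hx hxI
    rw [hx, hT, indicator_of_notMem]
    exact fun h : x ∈ Ioi a ↦ not_lt.2 hxI.2 h
  have hD := Literature.Analysis.DeBrangesSpaces.SonineMellin.differentiableOn_mellin ha TL hTa
  have heq : mellin (TL : ℝ → ℂ) = mellin T := by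
    funext w
    simp only [mellin]
    refine integral_congr_ae ?_
    filter_upwards [ae_restrict_of_ae (s := Ioi (0 : ℝ)) hcoe] with t ht
    rw [ht]
  rw [heq] at hD
  refine hD.comp ((differentiableOn_const (1 : ℂ)).sub differentiableOn_id) (fun z hz ↦ ?_)
  simp only [mem_setOf_eq, sub_re, one_re] at hz ⊢
  linarith

/-- **The tail transform on `Re s > 1/2`, `s ≠ 1`** ("hence by analytic continuation"): with
`c = ∫₀^∞ g(u)du/u`, `∫_a^∞ t^{−s}F(t)dt = ζ(s)ĝ(s) + c·a^{1−s}/(1−s)`. Both `(s−1)·(LHS)` and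
`ζ₁(s)ĝ(s) − c·a^{1−s}` (`ζ(s) = ζ₁(s)/(s−1)`, Mathlib's entire `riemannZeta₁`) are holomorphic on the
half-plane `Re s > 1/2` and agree on `Re s > 1`. [cite: Burnol2004, Note 2.5 (TeX l.743–750)] -/
theorem mellin_indicator_eq (ha : 0 < a) (hgi : IntegrableOn g (Ioo a a⁻¹))
    (hgz : ∀ t, t ∉ Ioo a a⁻¹ → g t = 0) (hF : ∀ᵐ t : ℝ, F t = coPoissonSum g t) {s : ℂ}
    (hs : 1 / 2 < s.re) (hs1 : s ≠ 1) :
    mellin ((Ioi a).indicator (F : ℝ → ℂ)) (1 - s) =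
      riemannZeta s * rightMellin g s +
        (∫ u in Ioi (0 : ℝ), g u / (u : ℂ)) * (a : ℂ) ^ (1 - s) / (1 - s) := by
  set c : ℂ := ∫ u in Ioi (0 : ℝ), g u / (u : ℂ) with hc
  set U : Set ℂ := {z : ℂ | 1 / 2 < z.re} with hU
  set f : ℂ → ℂ := fun z ↦ (z - 1) * mellin ((Ioi a).indicator (F : ℝ → ℂ)) (1 - z) with hf
  set h : ℂ → ℂ := fun z ↦ riemannZeta₁ z * rightMellin g z - c * (a : ℂ) ^ (1 - z) with hh
  have ha0 : (a : ℂ) ≠ 0 := ofReal_ne_zero.2 ha.ne'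
  have hUo : IsOpen U := continuous_re.isOpen_preimage _ isOpen_Ioi
  have hfan : AnalyticOnNhd ℂ f U := by
    refine DifferentiableOn.analyticOnNhd ?_ hUo
    exact ((differentiableOn_id.sub (differentiableOn_const _)).mul
      (differentiableOn_mellin_indicator ha F))
  have hcpow : Differentiable ℂ (fun z : ℂ ↦ (a : ℂ) ^ (1 - z)) := fun z ↦
    ((differentiableAt_const _).sub differentiableAt_id).const_cpow (Or.inl ha0)
  have hhan : AnalyticOnNhd ℂ h U := by
    refine DifferentiableOn.analyticOnNhd (fun z _ ↦ ?_) hUo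
    exact (((differentiable_riemannZeta₁ z).mul
      (differentiable_rightMellin_datum ha hgi hgz z)).sub
      ((differentiableAt_const c).mul (hcpow z))).differentiableWithinAt
  have hpre : IsPreconnected U := (convex_halfSpace_re_gt (1 / 2 : ℝ)).isPreconnected
  have h2 : (2 : ℂ) ∈ U := by simp [hU]; norm_num
  have hfg : f =ᶠ[𝓝 2] h := by
    have : ∀ᶠ z in 𝓝 (2 : ℂ), 1 < z.re :=
      (continuous_re.isOpen_preimage _ isOpen_Ioi).mem_nhds (by simp)
    filter_upwards [this] with z hz
    have hz1 : z ≠ 1 := fun h ↦ by simp [h] at hz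
    have hz2 : z - 1 ≠ 0 := sub_ne_zero.2 hz1
    have hz3 : 1 - z ≠ 0 := fun h ↦ hz2 (by rw [← neg_sub, h, neg_zero])
    simp only [hf, hh, mellin_indicator_eq_of_one_lt_re ha hgi hgz hF hz,
      riemannZeta_eq_inv_sub_mul hz1]
    field_simp
    ring
  have heq := hfan.eqOn_of_preconnected_of_eventuallyEq hhan hpre h2 hfg hs
  simp only [hf, hh] at heq
  have hs2 : s - 1 ≠ 0 := sub_ne_zero.2 hs1
  have hs3 : 1 - s ≠ 0 := fun h ↦ hs2 (by rw [← neg_sub, h, neg_zero])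
  rw [riemannZeta_eq_inv_sub_mul hs1]
  have key : mellin ((Ioi a).indicator (F : ℝ → ℂ)) (1 - s) =
      (riemannZeta₁ s * rightMellin g s - c * (a : ℂ) ^ (1 - s)) / (s - 1) := by
    rw [← heq]; field_simp
  rw [key]
  field_simp
  ring

end Tail

/-! ## §4 `F̂(s) = ζ(s)ĝ(s)` on the strip for `F ∈ P_a` -/

/-- **The co-Poisson sums correspond to `ζ(s)` under the right Mellin transform.** For `a > 0`,
`g ∈ L¹(a, 1/a)` (zero off `(a,1/a)`) and `F ∈ L²(ℝ)` with `F = Σ_{n≥1} g(|t|/n)/n − ∫₀^∞ g(u)du/u`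
a.e., the absolutely convergent right Mellin transform satisfies `F̂(s) = ζ(s)·ĝ(s)` on
`1/2 < Re s < 1` (`F̂(s) = −c·a^{1−s}/(1−s) + ∫_a^∞ F t^{−s}` by the tree's
`rightMellin_eq_of_ae_eq_const`, and §3). [cite: Burnol2004, §4 (TeX l.1384–1400), Note 2.5 (TeX l.737–758); Burnol2004b, §2 (arXiv:math/0203120v7 p. 5, TeX l.393–404)] -/
theorem rightMellin_eq_zeta_mul (ha : 0 < a) (hgi : IntegrableOn g (Ioo a a⁻¹))
    (hgz : ∀ t, t ∉ Ioo a a⁻¹ → g t = 0) {F : Lp ℂ 2 (volume : Measure ℝ)}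
    (hF : ∀ᵐ t : ℝ, F t = coPoissonSum g t) {s : ℂ} (hs1 : 1 / 2 < s.re) (hs2 : s.re < 1) :
    rightMellin (F : ℝ → ℂ) s = riemannZeta s * rightMellin g s := by
  have hsne : s ≠ 1 := fun h ↦ by rw [h, one_re] at hs2; exact lt_irrefl _ hs2
  have hs3 : (1 : ℂ) - s ≠ 0 := by
    intro h
    have := congrArg Complex.re h
    simp only [sub_re, one_re, zero_re] at this
    linarith
  obtain ⟨-, hFc, -⟩ := coPoissonSum_ae_eq_const ha hgi hgz hF
  rw [rightMellin_eq_of_ae_eq_const ha (F : ℝ → ℂ) (Lp.memLp F) hFc hs1 hs2,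
    mellin_indicator_eq ha hgi hgz hF hs1 hsne]
  field_simp
  ring

/-- **`F̂(s) = ζ(s)ĝ(s)` for `F ∈ P_a`** (the co-Poisson subspace of `BurnolZetaSystems.lean`), with
the datum `g` of the membership witness. [cite: Burnol2004, §4 (TeX l.1384–1400); Burnol2004b, §2 (arXiv:math/0203120v7 p. 5, TeX l.393–404, 493–498)] -/
theorem rightMellin_eq_zeta_mul_of_mem_coPoissonP (ha : 0 < a) {F : Lp ℂ 2 (volume : Measure ℝ)}
    (hF : F ∈ coPoissonP a) :
    ∃ g : ℝ → ℂ, IntegrableOn g (Ioo a a⁻¹) ∧ (∀ t, t ∉ Ioo a a⁻¹ → g t = 0) ∧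
      (∀ᵐ t : ℝ, F t = coPoissonSum g t) ∧
      ∀ s : ℂ, 1 / 2 < s.re → s.re < 1 →
        rightMellin (F : ℝ → ℂ) s = riemannZeta s * rightMellin g s := by
  obtain ⟨g, hgi, hgz, hFg⟩ := hF
  exact ⟨g, hgi, hgz, hFg, fun s hs1 hs2 ↦ rightMellin_eq_zeta_mul ha hgi hgz hFg hs1 hs2⟩

/-! ## §5 The continuation `G_F = ζ·ĝ`, the completed transform `Λ·ĝ`, and the vanishing of the
evaluations at the non-trivial zeros -/

/-- **`ζ(s)ĝ(s)` is THE continuation of `F̂` to `ℂ ∖ {1}`.** [cite: Burnol2004b, §2 and Prop. 2.2 (arXiv:math/0203120v7 p. 5, TeX l.393–404, 460–469)] -/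
theorem hasRightMellinContinuation (ha : 0 < a) (hgi : IntegrableOn g (Ioo a a⁻¹))
    (hgz : ∀ t, t ∉ Ioo a a⁻¹ → g t = 0) {F : Lp ℂ 2 (volume : Measure ℝ)}
    (hF : ∀ᵐ t : ℝ, F t = coPoissonSum g t) :
    HasRightMellinContinuation (F : ℝ → ℂ) (fun s ↦ riemannZeta s * rightMellin g s) := by
  refine ⟨fun s hs ↦ ?_, fun s hs1 hs2 ↦ (rightMellin_eq_zeta_mul ha hgi hgz hF hs1 hs2).symm⟩
  exact ((differentiableAt_riemannZeta hs).mul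
    (differentiable_rightMellin_datum ha hgi hgz s)).differentiableWithinAt

/-- **`G_F = ζ·ĝ` off `s = 1`** for the tree's `ε`-chosen continuation `rightMellinExt`.
[cite: Burnol2004b, §2 and Prop. 2.2 (arXiv:math/0203120v7 p. 5, TeX l.393–404, 460–469)] -/
theorem rightMellinExt_eq (ha : 0 < a) (hgi : IntegrableOn g (Ioo a a⁻¹))
    (hgz : ∀ t, t ∉ Ioo a a⁻¹ → g t = 0) {F : Lp ℂ 2 (volume : Measure ℝ)}
    (hF : ∀ᵐ t : ℝ, F t = coPoissonSum g t) {s : ℂ} (hs : s ≠ 1) :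
    rightMellinExt (F : ℝ → ℂ) s = riemannZeta s * rightMellin g s := by
  have h := hasRightMellinContinuation ha hgi hgz hF
  exact (hasRightMellinContinuation_rightMellinExt ⟨_, h⟩).eqOn h hs

/-- `Γ_ℝ` is differentiable where it does not vanish (its inverse is entire). [folklore] -/
private theorem differentiableAt_Gammaℝ {s : ℂ} (hs : Gammaℝ s ≠ 0) :
    DifferentiableAt ℂ Gammaℝ s := by
  have h : DifferentiableAt ℂ (fun z ↦ ((Gammaℝ z)⁻¹)⁻¹) s :=
    (differentiable_Gammaℝ_inv s).inv (inv_ne_zero hs)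
  simp only [inv_inv] at h
  exact h

/-- **The completed transform `M(F)(s) = Λ(s)·ĝ(s)`** on `0 < Re s`, `s ≠ 1`
(`M(F) = Γ_ℝ·G_F`, `Γ_ℝ·ζ = Λ = completedRiemannZeta`). [cite: Burnol2004b, §2 and Prop. 2.2 (arXiv:math/0203120v7 p. 5, TeX l.437–469)] -/
theorem completedMellin_eq (ha : 0 < a) (hgi : IntegrableOn g (Ioo a a⁻¹))
    (hgz : ∀ t, t ∉ Ioo a a⁻¹ → g t = 0) {F : Lp ℂ 2 (volume : Measure ℝ)}
    (hF : ∀ᵐ t : ℝ, F t = coPoissonSum g t) {s : ℂ} (hs0 : 0 < s.re) (hs : s ≠ 1) :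
    completedMellin (F : ℝ → ℂ) s = completedRiemannZeta s * rightMellin g s := by
  have hsz : s ≠ 0 := fun h ↦ by rw [h, zero_re] at hs0; exact lt_irrefl _ hs0
  have hΓ : Gammaℝ s ≠ 0 := Gammaℝ_ne_zero_of_re_pos hs0
  rw [completedMellin, rightMellinExt_eq ha hgi hgz hF hs, riemannZeta_def_of_ne_zero hsz]
  field_simp

/-- Near a point `w` with `0 < Re w`, `w ≠ 1`, the completed transform agrees with the analytic
function `ζ · (Γ_ℝ · ĝ)`. [folklore] -/
private theorem completedMellin_eventuallyEq (ha : 0 < a) (hgi : IntegrableOn g (Ioo a a⁻¹))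
    (hgz : ∀ t, t ∉ Ioo a a⁻¹ → g t = 0) {F : Lp ℂ 2 (volume : Measure ℝ)}
    (hF : ∀ᵐ t : ℝ, F t = coPoissonSum g t) {w : ℂ} (hw0 : 0 < w.re) (hw : w ≠ 1) :
    completedMellin (F : ℝ → ℂ) =ᶠ[𝓝 w]
      fun s ↦ riemannZeta s * (Gammaℝ s * rightMellin g s) := by
  have hopen : IsOpen ({s : ℂ | 0 < s.re} ∩ {s : ℂ | s ≠ 1}) :=
    (continuous_re.isOpen_preimage _ isOpen_Ioi).inter isOpen_ne
  filter_upwards [hopen.mem_nhds ⟨hw0, hw⟩] with s hs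
  rw [completedMellin, rightMellinExt_eq ha hgi hgz hF hs.2]
  ring

/-- For `ρ ≠ 1`, the integer multiplicity `m(ρ)` of the tree is the analytic order of `ζ` at `ρ`.
[folklore] -/
private theorem natCast_riemannZetaZeroOrder {ρ : ℂ} (hρ : ρ ≠ 1) :
    ∃ n : ℕ, analyticOrderAt riemannZeta ρ = n ∧ riemannZetaZeroOrder ρ = n := by
  have han : AnalyticAt ℂ riemannZeta ρ := analyticOn_riemannZeta ρ hρ
  have hne : analyticOrderAt riemannZeta ρ ≠ ⊤ := by
    intro htop
    have h2 : riemannZeta 2 = 0 :=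
      analyticOn_riemannZeta.eqOn_zero_of_preconnected_of_eventuallyEq_zero
        (isConnected_compl_singleton_of_one_lt_rank (by simp) (1 : ℂ)).isPreconnected hρ
        (analyticOrderAt_eq_top.mp htop) (show (2 : ℂ) ∈ ({1}ᶜ : Set ℂ) by norm_num)
    exact riemannZeta_ne_zero_of_one_le_re (s := 2) (by norm_num) h2
  obtain ⟨n, hn⟩ := ENat.ne_top_iff_exists.mp hne
  refine ⟨n, hn.symm, ?_⟩
  rw [riemannZetaZeroOrder, han.meromorphicOrderAt_eq, ← hn, ENat.map_coe, WithTop.untop₀_coe]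

/-- **The evaluations of a co-Poisson sum vanish at the non-trivial zeros**: for `F` as above,
every non-trivial zero `ρ` of `ζ` and every `k < m_ρ`, `M(F)^{(k)}(ρ) = 0` (`M(F) = Λ·ĝ = ζ·(Γ_ℝ ĝ)`
near `ρ`, and `ζ` vanishes to order `m_ρ` at `ρ`). This is the analytic content of "they are not
complete from the existence of the co-Poisson subspace `P_a`". [cite: Burnol2004b, Prop. 6.4 (arXiv:math/0203120v7 p. 16, TeX l.1282–1292)] -/
theorem burnolEval_eq_zero (ha : 0 < a) (hgi : IntegrableOn g (Ioo a a⁻¹))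
    (hgz : ∀ t, t ∉ Ioo a a⁻¹ → g t = 0) {F : Lp ℂ 2 (volume : Measure ℝ)}
    (hF : ∀ᵐ t : ℝ, F t = coPoissonSum g t) {ρ : ℂ}
    (hρ : ρ ∈ ZetaZeros.riemannZetaNontrivialZeros) {k : ℕ} (hk : (k : ℤ) < riemannZetaZeroOrder ρ) :
    burnolEval F ρ k = 0 := by
  obtain ⟨-, hρ0, hρ1⟩ := mem_riemannZetaNontrivialZeros_iff_holds.1 hρ
  have hρne : ρ ≠ 1 := fun h ↦ by rw [h, one_re] at hρ1; exact lt_irrefl _ hρ1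
  have hΓ : Gammaℝ ρ ≠ 0 := Gammaℝ_ne_zero_of_re_pos hρ0
  -- replace `M(F)` by the analytic germ `ζ · (Γ_ℝ ĝ)`
  rw [burnolEval, (completedMellin_eventuallyEq ha hgi hgz hF hρ0 hρne).iteratedDeriv_eq]
  -- analyticity of the two factors
  have hζ : AnalyticAt ℂ riemannZeta ρ := analyticOn_riemannZeta ρ hρne
  have hG : AnalyticAt ℂ (fun s ↦ Gammaℝ s * rightMellin g s) ρ := by
    have h1 : AnalyticAt ℂ Gammaℝ ρ := by
      have hopen : IsOpen {s : ℂ | 0 < s.re} := continuous_re.isOpen_preimage _ isOpen_Ioi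
      have hd : DifferentiableOn ℂ Gammaℝ {s : ℂ | 0 < s.re} := fun s hs ↦
        (differentiableAt_Gammaℝ (Gammaℝ_ne_zero_of_re_pos hs)).differentiableWithinAt
      exact hd.analyticOnNhd hopen ρ hρ0
    have h2 : AnalyticAt ℂ (rightMellin g) ρ :=
      (differentiable_rightMellin_datum ha hgi hgz).analyticAt ρ
    exact h1.mul h2
  have hprod : AnalyticAt ℂ (fun s ↦ riemannZeta s * (Gammaℝ s * rightMellin g s)) ρ := hζ.mul hG
  -- the order of the product is at least `m_ρ > k`
  obtain ⟨n, hn, hmn⟩ := natCast_riemannZetaZeroOrder hρne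
  have hkn : k < n := by
    rw [hmn] at hk
    exact_mod_cast hk
  have hle : ((k + 1 : ℕ) : ℕ∞) ≤
      analyticOrderAt (fun s ↦ riemannZeta s * (Gammaℝ s * rightMellin g s)) ρ := by
    have hfun : (fun s ↦ riemannZeta s * (Gammaℝ s * rightMellin g s)) =
        riemannZeta * fun s ↦ Gammaℝ s * rightMellin g s := rfl
    rw [hfun, analyticOrderAt_mul hζ hG, hn]
    have : ((k + 1 : ℕ) : ℕ∞) ≤ (n : ℕ∞) := by exact_mod_cast hkn
    exact this.trans le_self_add
  exact ((natCast_le_analyticOrderAt_iff_iteratedDeriv_eq_zero hprod).1 hle) k (Nat.lt_succ_self k)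

/-- **`M(F)^{(k)}(ρ) = 0` for `F ∈ P_a`**, `ρ` a non-trivial zero, `k < m_ρ`.
[cite: Burnol2004b, Prop. 6.4 (arXiv:math/0203120v7 p. 16, TeX l.1282–1292)] -/
theorem burnolEval_eq_zero_of_mem_coPoissonP (ha : 0 < a) {F : Lp ℂ 2 (volume : Measure ℝ)}
    (hF : F ∈ coPoissonP a) {ρ : ℂ} (hρ : ρ ∈ ZetaZeros.riemannZetaNontrivialZeros) {k : ℕ}
    (hk : (k : ℤ) < riemannZetaZeroOrder ρ) : burnolEval F ρ k = 0 := by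
  obtain ⟨g, hgi, hgz, hFg⟩ := hF
  exact burnolEval_eq_zero ha hgi hgz hFg hρ hk

/-- **`[F, Y^a_{ρ,k}] = 0`**: the co-Poisson subspace is orthogonal, for Burnol's bilinear form
`[f, g] = ∫₀^∞ fg`, to every evaluator of the first system (`P_a ⊆ L_a` and the defining relation of
`Y^a_{ρ,k}`). [cite: Burnol2004b, Thm. 3.1 and Prop. 6.4 (arXiv:math/0203120v7 pp. 6, 16; TeX l.516–525, 1282–1292)] -/
theorem setIntegral_mul_burnolY_eq_zero (ha : 0 < a) {F : Lp ℂ 2 (volume : Measure ℝ)}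
    (hF : F ∈ coPoissonP a) (p : ZetaZeroIndex) :
    ∫ t in Ioi (0 : ℝ), (F : ℝ → ℂ) t * (burnolYSystem a p : ℝ → ℂ) t = 0 := by
  have hY := BurnolEvaluators.isBurnolY_burnolYSystem ha p
  rw [burnolYSystem] at hY ⊢
  rw [hY.2 F (coPoissonP_subset_sonineL ha hF)]
  exact burnolEval_eq_zero_of_mem_coPoissonP ha hF p.2.1 p.2.2

/-! ## §6 `P_a` is stable under conjugation; `P_a ⊆ L_a ∩ Y_a^⊥` (Thm. 3.1, clause 3, inclusion) -/

/-- The co-Poisson sum (11) of the conjugate datum is the conjugate co-Poisson sum (the formula has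
real structure: real dilations `t/n`, weights `1/n`, and `∫₀^∞ ḡ(u)du/u = conj ∫₀^∞ g(u)du/u`).
[cite: Burnol2004b, §2 eq. (11) (arXiv:math/0203120v7 p. 5, TeX l.393–411)] -/
theorem coPoissonSum_conj (g : ℝ → ℂ) (t : ℝ) :
    coPoissonSum (fun u ↦ conj (g u)) t = conj (coPoissonSum g t) := by
  simp only [coPoissonSum, map_sub, Complex.conj_tsum, map_div₀, ← integral_conj, Complex.conj_ofReal,
    map_add, map_natCast, map_one]

/-- **`P_a` is stable under complex conjugation**: if `F ∈ P_a` has datum `g`, then `F̄ = star F`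
is the co-Poisson sum of `ḡ ∈ L¹(a, 1/a)`. [cite: Burnol2004b, §2 Definition of `P_a` (arXiv:math/0203120v7 p. 5, TeX l.493–498)] -/
theorem star_mem_coPoissonP {F : Lp ℂ 2 (volume : Measure ℝ)} (hF : F ∈ coPoissonP a) :
    star F ∈ coPoissonP a := by
  obtain ⟨g, hgi, hgz, hFg⟩ := hF
  refine ⟨fun u ↦ conj (g u), ?_, fun t ht ↦ by simp [hgz t ht], ?_⟩
  · have h := ContinuousLinearMap.integrable_comp (Complex.conjCLE : ℂ →L[ℝ] ℂ) hgi
    rw [IntegrableOn]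
    simpa using h
  · filter_upwards [Lp.coeFn_star F, hFg] with t h1 h2
    rw [h1, Pi.star_apply, coPoissonSum_conj, ← h2]
    rfl

/-- **`⟪Y^a_{ρ,k}, F⟫ = 0` for every `F ∈ P_a`** and every vector of the first system: the Hermitian
form of `L²(ℝ)` against Burnol's bilinear `[f, g] = ∫₀^∞ fg` on even classes,
`½⟪F, Y⟫ = ∫₀^∞ Y·F̄ = [F̄, Y] = M(F̄)^{(k)}(ρ) = 0` (`F̄ ∈ P_a`).
[cite: Burnol2004b, Thm. 3.1 (arXiv:math/0203120v7 p. 6, TeX l.516–525) and Prop. 6.4 proof (p. 16, TeX l.1287–1292)] -/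
theorem inner_burnolYSystem_eq_zero (ha : 0 < a) {F : Lp ℂ 2 (volume : Measure ℝ)}
    (hF : F ∈ coPoissonP a) (p : ZetaZeroIndex) : ⟪burnolYSystem a p, F⟫_ℂ = 0 := by
  have hYe : burnolYSystem a p ∈ evenL2 := (BurnolEvaluators.isBurnolY_burnolYSystem ha p).1.1
  have hFe : F ∈ evenL2 := (coPoissonP_subset_sonineL ha hF).1
  have h1 : ∫ t in Ioi (0 : ℝ), (burnolYSystem a p : ℝ → ℂ) t * conj ((F : ℝ → ℂ) t) =
      (1 / 2 : ℂ) * ⟪F, burnolYSystem a p⟫_ℂ :=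
    BurnolEvaluators.setIntegral_mul_conj_eq_half_inner hYe hFe
  have h2 : ∫ t in Ioi (0 : ℝ), (burnolYSystem a p : ℝ → ℂ) t * conj ((F : ℝ → ℂ) t) =
      ∫ t in Ioi (0 : ℝ), ((star F : Lp ℂ 2 (volume : Measure ℝ)) : ℝ → ℂ) t *
        (burnolYSystem a p : ℝ → ℂ) t := by
    refine integral_congr_ae (ae_restrict_of_ae ?_)
    filter_upwards [Lp.coeFn_star F] with t ht
    rw [ht, Pi.star_apply, mul_comm]
    rfl
  have h3 : ∫ t in Ioi (0 : ℝ), ((star F : Lp ℂ 2 (volume : Measure ℝ)) : ℝ → ℂ) t *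
      (burnolYSystem a p : ℝ → ℂ) t = 0 :=
    setIntegral_mul_burnolY_eq_zero ha (star_mem_coPoissonP hF) p
  have h4 : ⟪F, burnolYSystem a p⟫_ℂ = 0 := by
    have h := h1.symm.trans (h2.trans h3)
    simpa using h
  rw [← inner_conj_symm, h4, map_zero]

/-- **`P_a ⊆ L_a ∩ Y_a^⊥`** — the inclusion half of clause 3 of Thm. 3.1 ("For `a < 1` the
perpendicular complement to `Y_a` is the co-Poisson subspace `P_a`"), in the shape of the hypothesis
`hperp` of the tree's assembly `Burnol2004b_thm3_1_of`; valid for every `a > 0` (for `a ≥ 1`,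
`P_a = {0}`). The reverse inclusion is [Burnol2004, Thms. 6.24, 6.25] and is NOT proved here.
[cite: Burnol2004b, Thm. 3.1 (arXiv:math/0203120v7 p. 6, TeX l.516–525); §6 (p. 16, TeX l.1294–1300)] -/
theorem coPoissonP_subset_sonineL_inter_orthogonal (ha : 0 < a) :
    coPoissonP a ⊆
      {f | f ∈ sonineL a ∧ ∀ p : ZetaZeroIndex, inner ℂ (burnolYSystem a p) f = 0} :=
  fun _ hF ↦ ⟨coPoissonP_subset_sonineL ha hF, fun p ↦ inner_burnolYSystem_eq_zero ha hF p⟩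

/-- `P_a ⊆ (span{Y^a_{ρ,k}})^⊥` in Mathlib's orthogonal-complement language.
[cite: Burnol2004b, Thm. 3.1 (arXiv:math/0203120v7 p. 6, TeX l.516–525)] -/
theorem mem_orthogonal_span_burnolYSystem (ha : 0 < a) {F : Lp ℂ 2 (volume : Measure ℝ)}
    (hF : F ∈ coPoissonP a) : F ∈ (Submodule.span ℂ (Set.range (burnolYSystem a)))ᗮ := by
  rw [Submodule.mem_orthogonal]
  intro u hu
  refine Submodule.span_induction (p := fun u _ ↦ ⟪u, F⟫_ℂ = 0) ?_ ?_ ?_ ?_ hu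
  · rintro _ ⟨p, rfl⟩
    exact inner_burnolYSystem_eq_zero ha hF p
  · exact inner_zero_left F
  · intro x y _ _ hx hy
    rw [inner_add_left, hx, hy, add_zero]
  · intro c x _ hx
    rw [inner_smul_left, hx, mul_zero]

/-- `P_a ⊥ Y_a`: every `F ∈ P_a` is orthogonal to the closed span `Y_a` of the first system.
[cite: Burnol2004b, Thm. 3.1 (arXiv:math/0203120v7 p. 6, TeX l.516–525)] -/
theorem inner_eq_zero_of_mem_burnolYa (ha : 0 < a) {F : Lp ℂ 2 (volume : Measure ℝ)}
    (hF : F ∈ coPoissonP a) {y : Lp ℂ 2 (volume : Measure ℝ)} (hy : y ∈ burnolYa a) :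
    ⟪y, F⟫_ℂ = 0 := by
  have hcl : IsClosed {y : Lp ℂ 2 (volume : Measure ℝ) | ⟪y, F⟫_ℂ = 0} :=
    isClosed_eq (continuous_id.inner continuous_const) continuous_const
  exact closure_minimal (fun u hu ↦ (Submodule.mem_orthogonal _ _).1
    (mem_orthogonal_span_burnolYSystem ha hF) u hu) hcl hy

/-- **"Not complete from the existence of the co-Poisson subspace `P_a`"** — the mechanism of the
proof of Prop. 6.4, for a general datum and any `a > 0`: a non-zero element of `P_a` lies in `L_a` and
is orthogonal to the closed span `Y_a`, so the `Y^a_{ρ,k}` are not complete in `L_a`. (For `0 < a < 1`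
a non-zero element of `P_a` exists and the conclusion is the tree's
`not_isCompleteSystemIn_sonineL_burnolYSystem` of `BurnolCoPoissonEvaluatorOrthogonality.lean`, not
restated here.) [cite: Burnol2004b, Prop. 6.4 proof (arXiv:math/0203120v7 p. 16, TeX l.1287–1292)] -/
theorem not_isCompleteSystemIn_of_mem_coPoissonP (ha : 0 < a) {F : Lp ℂ 2 (volume : Measure ℝ)}
    (hF : F ∈ coPoissonP a) (hF0 : F ≠ 0) : ¬ IsCompleteSystemIn (sonineL a) (burnolYSystem a) := by
  rintro ⟨-, hsub⟩
  have hy : F ∈ burnolYa a := hsub (coPoissonP_subset_sonineL ha hF)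
  exact hF0 (inner_self_eq_zero.1 (inner_eq_zero_of_mem_burnolYa ha hF hy))

end CoPoissonMellin

end Literature.NumberTheory.LFunctions

end
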